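import Summits.CriticalPhenomena.PercolationContinuityZ3.Theorems.Transplant.Slab111VSoundB
import HarnessLib
/-!
# The routing certificate for `ShapedLinkage 3 (Slab111.hexShadow k)`, IV′: soundness of the checker — the RIDE

builds on p205010 (kernel theorem, internal audit signed; external expert review pending) — NOT used in this file.  Lane `prim-bschramm`, seat
`prim-bschramm-p2` (gen 35; class C1b; memo `HOME/bschramm/P2-LATTICES.md` §129); helper file (`--supports stmt-CriticalPhenomena-4575 --as helper`).
From a well-formed ride attachment `a` (`AttD.ok`, «Slab111VPlan»), a port level and a terminal `X` over the column `a.c` whose status the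
attachment serves (`rideStatusOK`), the RIDE — the helix of the face `a.F` between the port and the terminal's level («Slab111VRide»), plus the extra
step when `a.ext ≠ 0` — is a self-avoiding film path from the port vertex to `X`, all of whose vertices lie over the footprint columns, at levels
between the port and the terminal (up to the extra step), and in the cleared set («Slab111VSoundB»).
* **`ride_exists`**: the ride as a `GPath` with its vertex bounds.
[cite: DuminilCopinSidoraviciusTassion2016, §2.3 (proof of Fact 2: the paths γ_u, γ_v, γ_w)]
-/

noncomputable section

namespace Summit.CriticalPhenomena.PercolationContinuityZ3.Theorems.Transplant

open Literature.Probability.Percolation Literature.Probability.LatticeModels SimpleGraph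
open scoped Classical

namespace Slab111

variable {k : ℕ}

/-! ## The ride -/

/-- **THE RIDE.**  For a well-formed attachment `a`, a valid port `p` (a relative vertex over a face column, at an envelope level, in range and
cleared) and a terminal `X` over `a.c` at a level whose status the attachment serves, there is a self-avoiding film path from the port's vertex to `X`
whose vertices lie over the footprint, at levels between the port level and the terminal's face level (or at `X`), all cleared (over the rerouting
block for `E`-terminals). [cite: DuminilCopinSidoraviciusTassion2016, §2.3 (proof of Fact 2: γ_u, γ_v, γ_w)] -/
theorem ride_exists {z : Site 2} {ℓ : ℤ} {K : BKey} (hℓ : ℓ % 3 = (cls z : ℤ)) (hk5 : 5 ≤ k) {a : AttD} {roleE : Bool}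
    (ha : a.ok (Ctx.of K (cls z) (k % 3)) roleE = true) {p : MV} (hpv : vOK p = true) (hpF : p.1 ∈ a.fcols) (hp0 : 0 ≤ ℓ + p.2) (hpk : ℓ + p.2 ≤ k)
    (hpW : absV k z ℓ p ∈ Wset k z K.tR K.tD K.sR K.sD)
    (hport0 : ℓ + p.2 = 0 → codeFree (Ctx.of K (cls z) (k % 3)) 1 (a.colBot (cls z) 1) = true)
    (hportk : ℓ + p.2 = k → codeFree (Ctx.of K (cls z) (k % 3)) 2 (a.colTop (cls z) (k % 3) 1) = true)
    {X : slab111 k} (hXc : sh X = vcol z a.c) (hXW : X ∈ Wset k z K.tR K.tD K.sR K.sD)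
    (hXR : roleE = true → X ∈ Wset k z K.tR K.tD K.sR K.sD ∩ (hexShadow k).lift (blkR 3 z K.tR K.sR))
    (hstat : rideStatusOK (Ctx.of K (cls z) (k % 3)) a (statusOf k (lev (X : Site 3))) = true) :
    ∃ R : List (slab111 k), GPath (film k) R (absV k z ℓ p) X ∧
      (∀ v ∈ R, ∃ q ∈ a.foot, sh v = vcol z q) ∧
      (∀ v ∈ R, (min (ℓ + p.2) (lev (X : Site 3) + a.ext) ≤ lev (v : Site 3) ∧ lev (v : Site 3) ≤ max (ℓ + p.2) (lev (X : Site 3) + a.ext)) ∨ v = X) ∧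
      (∀ v ∈ R, v ∈ Wset k z K.tR K.tD K.sR K.sD) ∧
      (roleE = true → ∀ v ∈ R, v ∈ Wset k z K.tR K.tD K.sR K.sD ∩ (hexShadow k).lift (blkR 3 z K.tR K.sR)) := by
  -- notation and basic facts
  set c0 : ℤ := (cls z : ℤ) with hc0
  set h : ℤ := lev (X : Site 3) with hh
  set Lp : ℤ := ℓ + p.2 with hLp
  set t : ℤ := h + a.ext with ht
  have hz : (3 : ℤ) ∣ z 0 + 2 * z 1 - c0 := dvd_cls z
  obtain ⟨hF, hcols, hcc, hext⟩ := AttD.ok_cols ha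
  have hXadm : Adm k (sh X) h := adm_self X
  have hh0 : 0 ≤ h := hXadm.2.1
  have hhk : h ≤ k := hXadm.2.2
  -- the class of h: h ≡ c0 + lvlC a.c
  have hhcls : (3 : ℤ) ∣ h - c0 - lvlC a.c := by
    have h1 := hXadm.1
    rw [hXc] at h1
    simp only [lvl, vcol_apply_zero, vcol_apply_one, lvlC] at h1 ⊢
    have e : h - c0 - (a.c.1 + 2 * a.c.2) = (h - (z 0 + a.c.1 + 2 * (z 1 + a.c.2))) + (z 0 + 2 * z 1 - c0) := by ring
    rw [e]; exact dvd_add h1 hz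
  -- ext ∈ {0, 1, -1} and the range of t
  have hext3 : a.ext = 0 ∨ a.ext = -1 ∨ a.ext = 1 := by
    rcases hext with ⟨h1, -⟩ | ⟨h1, -⟩ | ⟨h1, -⟩
    · exact Or.inl h1
    · exact Or.inr (Or.inl h1)
    · exact Or.inr (Or.inr h1)
  have hstat_cases := statusOf_cases hk5 hh0 hhk (k := k)
  have ht0 : 0 ≤ t := by
    rcases hext3 with he | he | he
    · omega
    · -- ext = -1 needs h ≥ 1: status 0 excluded
      by_contra hcon
      have hh00 : h = 0 := by omega
      have hs0 : statusOf k h = 0 := by have := statusOf_low (k := k) hh0 (by omega); omega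
      rw [hs0] at hstat
      exact (rideStatusOK_low (by norm_num) hstat).1 ⟨he, rfl⟩
    · omega
  have htk : t ≤ k := by
    rcases hext3 with he | he | he
    · omega
    · omega
    · by_contra hcon
      have hhk' : h = k := by omega
      have hs12 : statusOf k h = 12 := by have := statusOf_high (k := k) hk5 (by omega) hhk; omega
      rw [hs12] at hstat
      exact (rideStatusOK_high (by norm_num) hstat).1 ⟨he, rfl⟩
  -- the port is the face vertex of its level
  have hpadm : MAdm k (shiftMV z ℓ p) := madm_absV hℓ hpv hp0 hpk
  have hpcol : colAt a.F (Lp - c0) = p.1 := by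
    apply colAt_eq_of_mem hF hpF
    have h1 : (3 : ℤ) ∣ p.2 - (p.1.1 + 2 * p.1.2) := vOK_iff.1 hpv
    have h2 : (3 : ℤ) ∣ ℓ - (z 0 + 2 * z 1) := dvd_of_emod_eq_cls hℓ
    have e : Lp - c0 - lvlC p.1 = (p.2 - (p.1.1 + 2 * p.1.2)) + (ℓ - (z 0 + 2 * z 1)) + (z 0 + 2 * z 1 - c0) := by simp only [hLp, lvlC]; ring
    rw [e]; exact dvd_add (dvd_add h1 h2) hz
  have hport_eq : absV k z ℓ p = rideV k z c0 a.F Lp :=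
    rideV_eq_of_sh_lev hz hF hp0 hpk (by rw [sh_absV_vcol hpadm, hpcol]) (lev_absV hpadm)
  -- the target face vertex Y at level t, its column is a.tcol (and = a.c when ext = 0)
  have htcol : colAt a.F (t - c0) = a.tcol := by
    unfold AttD.tcol
    apply colAt_congr
    have e : t - c0 - (lvlC a.c + a.ext) = h - c0 - lvlC a.c := by rw [ht]; ring
    rw [e]; exact hhcls
  -- cleared-set membership of every face vertex at a level between Lp and t
  have hmemL : ∀ L : ℤ, min Lp t ≤ L → L ≤ max Lp t → rideV k z c0 a.F L ∈ Wset k z K.tR K.tD K.sR K.sD ∧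
      (roleE = true → rideV k z c0 a.F L ∈ Wset k z K.tR K.tD K.sR K.sD ∩ (hexShadow k).lift (blkR 3 z K.tR K.sR)) := by
    intro L hL1 hL2
    have hL0 : 0 ≤ L := by have := le_min hp0 ht0; omega
    have hLk : L ≤ k := by have := max_le hpk htk; omega
    by_cases hLport : L = Lp
    · -- the port itself
      subst hLport
      rw [← hport_eq]
      exact ⟨hpW, fun hr => mem_WR_absV hℓ hpv hp0 hpk hpW (colRW_split ((hcols p.1 hpF).2 hr)).1⟩
    apply rideV_mem_W ha hL0 hLk
    · -- L = 0: then t = 0 (the port is not at this level): low status with t ≤ 0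
      intro hL
      have ht00 : t = 0 := by
        rcases le_total Lp t with hc | hc
        · rw [min_eq_left hc] at hL1; omega
        · rw [min_eq_right hc] at hL1; omega
      have hh2 : h ≤ 2 := by omega
      have hs := statusOf_low (k := k) hh0 hh2
      obtain ⟨-, hc0', -⟩ := rideStatusOK_low (by omega) hstat
      have := hc0' (by rw [hs]; omega)
      have e : a.colBot (cls z) 0 = colAt a.F (L - cls z) := by unfold AttD.colBot; rw [hL]
      rw [Ctx.of_c0, e] at this; exact this
    · -- L = 1: either the port is at level 0 (then hport0) or t ≤ 1 (status check)
      intro hL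
      rcases le_total Lp t with hc | hc
      · rw [min_eq_left hc] at hL1
        rcases lt_or_eq_of_le hL1 with hlt | heq
        · -- Lp < 1, Lp ≥ 0 → Lp = 0
          have hLp0 : ℓ + p.2 = 0 := by simp only [hLp] at hlt; omega
          have := hport0 hLp0
          have e : a.colBot (cls z) 1 = colAt a.F (L - cls z) := by unfold AttD.colBot; rw [hL]
          rw [e] at this; exact this
        · exact absurd heq.symm (hL ▸ hLport)
      · rw [min_eq_right hc] at hL1
        have hh2 : h ≤ 2 := by omega
        have hs := statusOf_low (k := k) hh0 hh2
        obtain ⟨-, -, hc1'⟩ := rideStatusOK_low (by omega) hstat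
        have := hc1' (by rw [hs]; omega)
        have e : a.colBot (cls z) 1 = colAt a.F (L - cls z) := by unfold AttD.colBot; rw [hL]
        rw [Ctx.of_c0, e] at this; exact this
    · -- L = k-1: either the port is at level k (then hportk) or t ≥ k-1 (status check)
      intro hL
      rcases le_total Lp t with hc | hc
      · rw [max_eq_right hc] at hL2
        have hhi : (k : ℤ) - 2 ≤ h := by omega
        have hs := statusOf_high (k := k) hk5 hhi hhk
        obtain ⟨-, -, hc2'⟩ := rideStatusOK_high (by omega) hstat
        have := hc2' (by rw [hs]; omega)
        have e : a.colTop (cls z) (k % 3) 1 = colAt a.F (L - cls z) := by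
          unfold AttD.colTop; apply colAt_congr; rw [hL]; have := Int.emod_emod_of_dvd (k : ℤ) (dvd_refl (3 : ℤ)); push_cast; omega
        rw [Ctx.of_c0, Ctx.of_kr, e] at this; exact this
      · rw [max_eq_left hc] at hL2
        rcases lt_or_eq_of_le hL2 with hlt | heq
        · have hLpk : ℓ + p.2 = k := by simp only [hLp] at hlt; omega
          have := hportk hLpk
          have e : a.colTop (cls z) (k % 3) 1 = colAt a.F (L - cls z) := by
            unfold AttD.colTop; apply colAt_congr; rw [hL]; have := Int.emod_emod_of_dvd (k : ℤ) (dvd_refl (3 : ℤ)); push_cast; omega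
          rw [e] at this; exact this
        · exact absurd heq (hL ▸ hLport)
    · -- L = k: then t = k (the port is not at this level)
      intro hL
      have htk' : t = k := by
        rcases le_total Lp t with hc | hc
        · rw [max_eq_right hc] at hL2; omega
        · rw [max_eq_left hc] at hL2; omega
      have hhi : (k : ℤ) - 2 ≤ h := by omega
      have hs := statusOf_high (k := k) hk5 hhi hhk
      obtain ⟨-, hc3', -⟩ := rideStatusOK_high (by omega) hstat
      have := hc3' (by rw [hs]; omega)
      have e : a.colTop (cls z) (k % 3) 0 = colAt a.F (L - cls z) := by
        unfold AttD.colTop; apply colAt_congr; rw [hL]; have := Int.emod_emod_of_dvd (k : ℤ) (dvd_refl (3 : ℤ)); push_cast; omega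
      rw [Ctx.of_c0, Ctx.of_kr, e] at this; exact this
  -- the helix segment between Lp and t
  set lo := min Lp t with hlo
  set n : ℕ := (max Lp t - lo).toNat with hn
  have hlon : lo + n = max Lp t := by
    have : lo ≤ max Lp t := (min_le_left _ _).trans (le_max_left _ _)
    simp only [hn]; omega
  have hlo0 : 0 ≤ lo := by simp only [hlo]; exact le_min hp0 ht0
  have hhik : lo + n ≤ k := by rw [hlon]; exact max_le hpk htk
  have hseg := ride_gpath (k := k) hz hF hlo0 (n := n) hhik
  -- vertex facts of the segment
  have hsegSh : ∀ v ∈ rideL k z c0 a.F lo n, ∃ q ∈ a.foot, sh v = vcol z q := by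
    intro v hv
    rcases sh_mem_of_mem_rideL hz hF hlo0 hhik hv with e | e | e
    · exact ⟨a.F.f0, fcols_subset_foot a (by simp [AttD.fcols]), e⟩
    · exact ⟨a.F.f1, fcols_subset_foot a (by simp [AttD.fcols]), e⟩
    · exact ⟨a.F.f2, fcols_subset_foot a (by simp [AttD.fcols]), e⟩
  have hsegLev : ∀ v ∈ rideL k z c0 a.F lo n, min Lp t ≤ lev (v : Site 3) ∧ lev (v : Site 3) ≤ max Lp t := by
    intro v hv
    have := lev_of_mem_rideL hz hF hlo0 hhik hv
    rw [hlon] at this; exact this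
  have hsegW : ∀ v ∈ rideL k z c0 a.F lo n, v ∈ Wset k z K.tR K.tD K.sR K.sD ∧
      (roleE = true → v ∈ Wset k z K.tR K.tD K.sR K.sD ∩ (hexShadow k).lift (blkR 3 z K.tR K.sR)) := by
    intro v hv
    obtain ⟨i, hi, rfl⟩ := mem_rideL.1 hv
    exact hmemL _ (by simp only [hlo]; omega) (by omega)
  -- orient the segment from the port to the face vertex at level t
  have hends : (lo = Lp ∧ lo + n = t) ∨ (lo = t ∧ lo + n = Lp) := by
    rcases le_total Lp t with hc | hc
    · left; exact ⟨by simp only [hlo]; exact min_eq_left hc, by rw [hlon]; exact max_eq_right hc⟩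
    · right; exact ⟨by simp only [hlo]; exact min_eq_right hc, by rw [hlon]; exact max_eq_left hc⟩
  obtain ⟨R₀, hR₀path, hR₀mem⟩ : ∃ R₀ : List (slab111 k), GPath (film k) R₀ (rideV k z c0 a.F Lp) (rideV k z c0 a.F t) ∧
      ∀ v ∈ R₀, v ∈ rideL k z c0 a.F lo n := by
    rcases hends with ⟨h1, h2⟩ | ⟨h1, h2⟩
    · refine ⟨rideL k z c0 a.F lo n, ?_, fun v hv => hv⟩
      have := hseg; rw [h2] at this; rw [h1] at this ⊢; exact this
    · refine ⟨(rideL k z c0 a.F lo n).reverse, ?_, fun v hv => List.mem_reverse.1 hv⟩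
      have := hseg.reverse; rw [h2] at this; rw [h1] at this ⊢; exact this
  rw [← hport_eq] at hR₀path
  -- finish: ext = 0 (X is the face vertex at level t) or append the extra step
  rcases hext with ⟨he, hcF⟩ | ⟨he, hcF, hup⟩ | ⟨he, hcF, hup⟩
  · -- ext = 0: X = rideV t
    have hth : t = h := by rw [ht, he]; ring
    have hXeq : X = rideV k z c0 a.F t := by
      apply rideV_eq_of_sh_lev hz hF ht0 htk
      · rw [hXc, colAt_eq_of_mem hF hcF]; rw [hth]; exact hhcls
      · rw [hth]
    refine ⟨R₀, hXeq ▸ hR₀path, fun v hv => hsegSh v (hR₀mem v hv), fun v hv => Or.inl ?_, fun v hv => (hsegW v (hR₀mem v hv)).1,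
      fun hr v hv => (hsegW v (hR₀mem v hv)).2 hr⟩
    exact hsegLev v (hR₀mem v hv)
  all_goals
    -- ext = ∓1: the face vertex Y at level t is adjacent to X; append X
    have hYadm : Adm k (vcol z (colAt a.F (t - c0))) t := adm_rideV hz hF ht0 htk
    have hXvl : X = vl k (vcol z a.c) h := by rw [← hXc]; exact eq_vl_self X
    have hXadm' : Adm k (vcol z a.c) h := by rw [← hXc]; exact hXadm
    have hXnot : X ∉ R₀ := by
      intro hX
      have hs := sh_mem_of_mem_rideL hz hF hlo0 hhik (hR₀mem X hX)
      rw [hXc] at hs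
      rcases hs with e | e | e <;> have := vcol_injective z e <;> exact hcF (by simp [AttD.fcols, this])
    have hadj : (film k).Adj (rideV k z c0 a.F t) X := by
      rw [hXvl]; unfold rideV; rw [htcol] at hYadm ⊢
      first
        | -- ext = -1: (tcol, h-1) → (c, h) is an up-step
          (have e : h = t + 1 := by rw [ht, he]; ring
           rw [e] at hXadm' ⊢
           rcases vcol_of_isUp (z := z) hup with hq | hq | hq <;> rw [hq] at hXadm' ⊢
           · exact adj_vl_u₁ hYadm hXadm'
           · exact adj_vl_u₂ hYadm hXadm'
           · exact adj_vl_u₃ hYadm hXadm')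
        | -- ext = +1: (c, h) → (tcol, h+1) is an up-step
          (have e : t = h + 1 := by rw [ht, he]
           rw [e] at hYadm ⊢
           rcases vcol_of_isUp (z := z) hup with hq | hq | hq <;> rw [hq] at hYadm ⊢
           · exact (adj_vl_u₁ hXadm' hYadm).symm
           · exact (adj_vl_u₂ hXadm' hYadm).symm
           · exact (adj_vl_u₃ hXadm' hYadm).symm)
    have hfull := hR₀path.trans (GPath.pair hadj) (fun v hv hvR => by
      rcases List.mem_cons.1 hv with rfl | hv
      · rfl
      · simp only [List.mem_singleton] at hv; exact absurd (hv ▸ hvR) hXnot)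
    refine ⟨R₀ ++ [X], by simpa using hfull, fun v hv => ?_, fun v hv => ?_, fun v hv => ?_, fun hr v hv => ?_⟩
    · rcases List.mem_append.1 hv with hv | hv
      · exact hsegSh v (hR₀mem v hv)
      · simp only [List.mem_singleton] at hv; exact ⟨a.c, c_mem_foot a, hv ▸ hXc⟩
    · rcases List.mem_append.1 hv with hv | hv
      · left; exact hsegLev v (hR₀mem v hv)
      · right; simpa using hv
    · rcases List.mem_append.1 hv with hv | hv
      · exact (hsegW v (hR₀mem v hv)).1
      · simp only [List.mem_singleton] at hv; exact hv ▸ hXW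
    · rcases List.mem_append.1 hv with hv | hv
      · exact (hsegW v (hR₀mem v hv)).2 hr
      · simp only [List.mem_singleton] at hv; exact hv ▸ hXR hr

end Slab111

end Summit.CriticalPhenomena.PercolationContinuityZ3.Theorems.Transplant
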